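import Mathlib.Topology.Sheaves.Stalks
import Literature.AlgebraicGeometry.Motives.UnramifiedCohomology
import HarnessLib

/-!
# Betti cohomology of the function field `H^q(ℂ(X); A)` and the coniveau kernel (Bloch–Ogus (3.8))

Companion to `Motives/UnramifiedCohomology`. For an irreducible scheme `X` over `ℂ` with generic point
`η`, a coefficient ring `A` and a degree `q`:

* `functionFieldCohomology A X q = H^q(ℂ(X); A)` — the **Betti cohomology of the function field**,
  the stalk at `η` of the Zariski presheaf `U ↦ H^q(U(ℂ); A)` (`bettiZariskiPresheaf`), i.e. the
  filtered colimit `colim_{U ∋ η} H^q(U(ℂ); A) = colim_{U ≠ ∅ open} H^q(U(ℂ); A)` (every non-empty open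
  contains `η`): Bloch–Ogus 1974, (3.9) ("`H*(x, n) = lim_{U ⊆ {x}⁻} H*(U, n)`" at the generic point)
  and Colliot-Thélène–Voisin 2012, §2.1 ("`Hⁱ_B(ℂ(D), A) = lim_{U ⊂ D ouvert de Zariski non vide}
  Hⁱ(U(ℂ), A)`", with `D = X`);
* `germToFunctionField`, `toFunctionField A X q : H^q(X(ℂ); A) ⟶ H^q(ℂ(X); A)` — the germ maps and
  the restriction to the generic point;
* `toFunctionField_eq_zero_iff` — a class dies at the generic point iff it dies on the complex
  points of some non-empty Zariski open (filtered colimits in `ModuleCat`, Mathlib's `germ_eq`);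
* `ker_toFunctionField_eq_coniveauFiltration_one` — **Bloch–Ogus (3.8) for `p = 1`, PROVED**:
  `N¹ H^q(X(ℂ); A) = ker (H^q(X(ℂ); A) → H^q(ℂ(X); A))` ("`Nᵖ H(X) = Ker (H(X) → lim_{Z ∈ Zᵖ} H(X − Z))`";
  for `X` irreducible the closed `Z` of codimension `≥ 1` are exactly the `Z ≠ X`, and the `X − Z`
  the non-empty opens).

With `Motives/UnramifiedCohomology` this gives the picture of Colliot-Thélène–Voisin 2012, Thm. 2.8
(ii), "l'image de `Hⁱ(X(ℂ), A)` dans `Hⁱ_nr(X, A) ⊂ Hⁱ_B(ℂ(X), A)`": unconditionally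
`ker (H^q(X(ℂ)) → H^q_nr(X)) ≤ N¹ H^q = ker (H^q(X(ℂ)) → H^q(ℂ(X)))`
(`toFunctionField_eq_zero_of_unramifiedClass_eq_zero`), with equality for `X` smooth granted the
named fact `BlochOgus1974_blochOgusSheaf_injective` (`unramifiedClass_eq_zero_iff_toFunctionField_eq_zero`).
No new named fact is introduced here.

## Design notes

* The stalk is Mathlib's `TopCat.Presheaf.stalk` of `bettiZariskiPresheaf A X q` viewed as a
  presheaf on `TopCat.of X.left` (`bettiZariskiTopPresheaf`, an `abbrev`), so `germ`, `germ_res_apply`,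
  `germ_eq` (forgetful functor of `ModuleCat` preserves filtered colimits) apply verbatim.
* NOT here: the embedding `H^q_nr(X, A) ↪ H^q(ℂ(X); A)` of ALL unramified classes (needs the stalk
  comparison for the sheafification together with Bloch–Ogus injectivity), residues, and the
  function field as a field (only its cohomology, as a colimit, is used).

## References

* [BlochOgus1974ENS] S. Bloch, A. Ogus, *Gersten's conjecture and the homology of schemes*, Ann.
  Sci. ÉNS (4) 7 (1974), (3.8) (`Nᵖ H` as a kernel), (3.9) (`H*(x, n)` as a colimit).
* [ColliotTheleneVoisin2012] J.-L. Colliot-Thélène, C. Voisin, *Cohomologie non ramifiée et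
  conjecture de Hodge entière*, Duke Math. J. 161 (2012), §2.1 (`Hⁱ_B(ℂ(D), A)`), Thm. 2.8 (ii).
-/

noncomputable section

open CategoryTheory AlgebraicGeometry Opposite TopologicalSpace
open Literature.AlgebraicTopology.SingularHomology

namespace Literature.AlgebraicGeometry.Motives

universe u

variable (A : Type) [CommRing A] (X : SchemeOver ℂ) (q : ℕ)

/-! ### Generic points of opens -/

/-- The generic point of an irreducible scheme lies in every non-empty open. [folklore] -/
theorem genericPoint_mem_of_nonempty {Y : Scheme.{u}} [IrreducibleSpace Y] {U : Y.Opens}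
    (hU : (U : Set Y).Nonempty) : genericPoint Y ∈ U := by
  change genericPoint Y ∈ (U : Set Y)
  rw [(genericPoint_spec Y).mem_open_set_iff U.isOpen, Set.univ_inter]
  exact hU

/-- An open of an irreducible scheme is non-empty iff it contains the generic point. [folklore] -/
theorem genericPoint_mem_iff_nonempty {Y : Scheme.{u}} [IrreducibleSpace Y] {U : Y.Opens} :
    genericPoint Y ∈ U ↔ (U : Set Y).Nonempty :=
  ⟨fun h ↦ ⟨_, h⟩, genericPoint_mem_of_nonempty⟩

/-! ### The generic stalk `H^q(ℂ(X); A)` -/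

/-- The Zariski presheaf `U ↦ H^q(U(ℂ); A)` as a presheaf on the object `TopCat.of X` (same functor;
fixes the `TopCat` for Mathlib's stalk API). [cite: BlochOgus1974ENS, §4] -/
abbrev bettiZariskiTopPresheaf : TopCat.Presheaf (ModuleCat.{0} A) (TopCat.of X.left) :=
  bettiZariskiPresheaf A X q

/-- The **Betti cohomology of the function field** `H^q(ℂ(X); A)` of an irreducible `X` over `ℂ`:
the stalk at the generic point `η` of the Zariski presheaf `U ↦ H^q(U(ℂ); A)`, i.e.
`colim_{U ∋ η} H^q(U(ℂ); A) = colim_{∅ ≠ U open} H^q(U(ℂ); A)` (Bloch–Ogus 1974, (3.9), at the generic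
point; Colliot-Thélène–Voisin 2012, §2.1, `Hⁱ_B(ℂ(X), A)`).
[cite: ColliotTheleneVoisin2012, §2.1 (definition of H_B(ℂ(D), A))] -/
def functionFieldCohomology [IrreducibleSpace X.left] : ModuleCat.{0} A :=
  (bettiZariskiTopPresheaf A X q).stalk (genericPoint X.left)

/-- The germ map `H^q(U(ℂ); A) ⟶ H^q(ℂ(X); A)` of a Zariski open `U` containing the generic point
(i.e. non-empty): the colimit coprojection. [cite: BlochOgus1974ENS, (3.9)] -/
abbrev germToFunctionField [IrreducibleSpace X.left] (U : X.left.Opens)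
    (hU : genericPoint X.left ∈ U) :
    (bettiZariskiPresheaf A X q).obj (op U) ⟶ functionFieldCohomology A X q :=
  (bettiZariskiTopPresheaf A X q).germ U (genericPoint X.left) hU

/-- **Restriction to the generic point** `H^q(X(ℂ); A) ⟶ H^q(ℂ(X); A)`: restrict to `X(ℂ) = ⊤(ℂ)` and
take the germ at `η` (the map `H(X) → lim_{Z ∈ Z¹} H(X − Z)` of Bloch–Ogus 1974, (3.8)).
[cite: BlochOgus1974ENS, (3.8)] -/
def toFunctionField [IrreducibleSpace X.left] :
    singularCohomology A A (ComplexPoints X) q ⟶ functionFieldCohomology A X q :=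
  restrictToOpen A X q ⊤ ≫ germToFunctionField A X q ⊤ trivial

/-- Unfolding of `toFunctionField`. [cite: BlochOgus1974ENS, (3.8)] -/
theorem toFunctionField_apply [IrreducibleSpace X.left]
    (z : singularCohomology A A (ComplexPoints X) q) :
    toFunctionField A X q z = germToFunctionField A X q ⊤ trivial (restrictToOpen A X q ⊤ z) :=
  rfl

/-- The germ at `η` of `z|_{U(ℂ)}` is the restriction of `z` to the generic point, for every open
`U ∋ η` (compatibility of germs with restriction). [cite: BlochOgus1974ENS, (3.8)–(3.9)] -/
theorem germToFunctionField_restrictToOpen [IrreducibleSpace X.left] (U : X.left.Opens)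
    (hU : genericPoint X.left ∈ U) (z : singularCohomology A A (ComplexPoints X) q) :
    germToFunctionField A X q U hU (restrictToOpen A X q U z) = toFunctionField A X q z := by
  rw [← map_restrictToOpen_apply A X q (homOfLE (le_top : U ≤ ⊤)) z]
  exact TopCat.Presheaf.germ_res_apply (bettiZariskiTopPresheaf A X q) (homOfLE le_top) _ hU _

/-- **A class dies at the generic point iff it dies on a non-empty Zariski open**: `z ↦ 0` in
`H^q(ℂ(X); A) = colim_{U ≠ ∅} H^q(U(ℂ); A)` iff `z|_{U(ℂ)} = 0` for some non-empty open `U` (elements of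
a filtered colimit of modules vanish iff they vanish at some stage). [cite: BlochOgus1974ENS, (3.8)] -/
theorem toFunctionField_eq_zero_iff [IrreducibleSpace X.left]
    (z : singularCohomology A A (ComplexPoints X) q) :
    toFunctionField A X q z = 0 ↔
      ∃ U : X.left.Opens, (U : Set X.left).Nonempty ∧ restrictToOpen A X q U z = 0 := by
  constructor
  · intro h
    have h' : germToFunctionField A X q ⊤ trivial (restrictToOpen A X q ⊤ z) =
        germToFunctionField A X q ⊤ trivial 0 := by
      rw [map_zero]
      exact h
    obtain ⟨W, hW, iU, iV, e⟩ :=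
      TopCat.Presheaf.germ_eq (bettiZariskiTopPresheaf A X q) (U := ⊤) (V := ⊤) (genericPoint X.left)
        trivial trivial _ _ h'
    refine ⟨W, ⟨_, hW⟩, ?_⟩
    have e' : (bettiZariskiPresheaf A X q).map iU.op (restrictToOpen A X q ⊤ z) =
        (bettiZariskiPresheaf A X q).map iV.op 0 := e
    rwa [map_zero, map_restrictToOpen_apply] at e'
  · rintro ⟨U, hU, h0⟩
    rw [← germToFunctionField_restrictToOpen A X q U (genericPoint_mem_of_nonempty hU), h0, map_zero]

/-- **Bloch–Ogus (3.8), the coniveau filtration as a kernel (`p = 1`), proved**: on an irreducible `X`,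
`ker (H^q(X(ℂ); A) → H^q(ℂ(X); A)) = N¹ H^q(X(ℂ); A)` — "`Nᵖ H(X) = Ker (H(X) → lim_{Z ∈ Zᵖ} H(X − Z))`",
the closed `Z` with all points of codimension `≥ 1` being exactly the `Z ≠ X`
(`forall_one_le_coheight_iff_ne_univ`) and the `X − Z` the non-empty opens.
[cite: BlochOgus1974ENS, (3.8)] -/
theorem ker_toFunctionField_eq_coniveauFiltration_one [IrreducibleSpace X.left] :
    LinearMap.ker (toFunctionField A X q).hom = coniveauFiltration A X q 1 := by
  ext z
  rw [LinearMap.mem_ker, mem_coniveauFiltration_iff_exists]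
  change toFunctionField A X q z = 0 ↔ _
  rw [toFunctionField_eq_zero_iff]
  constructor
  · rintro ⟨U, hU, h0⟩
    refine ⟨(U : Set X.left)ᶜ, U.isOpen.isClosed_compl,
      (forall_one_le_coheight_iff_ne_univ U.isOpen.isClosed_compl).2 ?_, h0⟩
    intro h
    obtain ⟨x, hx⟩ := hU
    have hx' : x ∈ (U : Set X.left)ᶜ := h ▸ Set.mem_univ x
    exact hx' hx
  · rintro ⟨Z, hZ, hr, h0⟩
    have hsub : Z ⊆ Zᶜᶜ := fun y hy hy' ↦ hy' hy
    exact ⟨⟨Zᶜ, hZ.isOpen_compl⟩, ⟨genericPoint X.left, genericPoint_notMem_of_forall_one_le_coheight hr⟩,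
      restrictToCompl_eq_zero_of_subset A X q hsub h0⟩

/-- `N¹ H^q(X(ℂ); A)` membership as vanishing at the generic point. [cite: BlochOgus1974ENS, (3.8)] -/
theorem mem_coniveauFiltration_one_iff_toFunctionField_eq_zero [IrreducibleSpace X.left]
    (z : singularCohomology A A (ComplexPoints X) q) :
    z ∈ coniveauFiltration A X q 1 ↔ toFunctionField A X q z = 0 := by
  rw [← ker_toFunctionField_eq_coniveauFiltration_one, LinearMap.mem_ker]

/-! ### Unramified class versus generic restriction -/

/-- Unconditionally (no smoothness), a class with vanishing unramified class vanishes at the generic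
point: `ker (H^q(X(ℂ)) → H^q_nr(X)) ≤ N¹ H^q = ker (H^q(X(ℂ)) → H^q(ℂ(X)))`.
[cite: ColliotTheleneVoisin2012, Thm. 2.8 (ii)] -/
theorem toFunctionField_eq_zero_of_unramifiedClass_eq_zero [IrreducibleSpace X.left]
    {z : singularCohomology A A (ComplexPoints X) q} (hz : unramifiedClass A X q z = 0) :
    toFunctionField A X q z = 0 :=
  (mem_coniveauFiltration_one_iff_toFunctionField_eq_zero A X q z).1
    (ker_unramifiedClass_le_coniveauFiltration_one A X q hz)

/-- For `X` smooth, separated, of finite type and irreducible over `ℂ`, granted Bloch–Ogus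
injectivity, the unramified class of `z ∈ H^q(X(ℂ); A)` vanishes iff its restriction to the generic
point does: on the image of `H^q(X(ℂ); A)`, the targets `H^q_nr(X, A) ⊂ H^q(ℂ(X); A)` see the same
kernel `N¹ H^q` (Colliot-Thélène–Voisin 2012, Thm. 2.8 (ii); Bloch–Ogus 1974, (3.8) with Cor. 6.3).
[cite: ColliotTheleneVoisin2012, Thm. 2.8 (ii)] -/
theorem unramifiedClass_eq_zero_iff_toFunctionField_eq_zero
    (hBO : BlochOgus1974_blochOgusSheaf_injective) [Smooth X.hom] [IsSeparated X.hom]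
    [QuasiCompact X.hom] [IrreducibleSpace X.left] (z : singularCohomology A A (ComplexPoints X) q) :
    unramifiedClass A X q z = 0 ↔ toFunctionField A X q z = 0 := by
  rw [← mem_coniveauFiltration_one_iff_toFunctionField_eq_zero,
    coniveauFiltration_one_eq_ker_unramifiedClass A X q hBO, LinearMap.mem_ker]

end Literature.AlgebraicGeometry.Motives

end
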